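import Summits.BirchSwinnertonDyer.BirchSwinnertonDyer.Theorems.ClassRecordThreeHalvesAtThreeNormContinuity
import Summits.BirchSwinnertonDyer.Rank1Residual.X11b.Three.BDPExistsFromPrint
import Summits.BirchSwinnertonDyer.Rank1Residual.X11b.Three.HsiehDescentSupplied
import HarnessLib

/-!
# Route `ClassRecordThree`, crux `ValueContinuityAtThree` (item stmt-BirchSwinnertonDyer-19493) FROM NORM CONTINUITY
# AT `𝟙` (VN₃), Hsieh's PUBLISHED existence theorem, and the route's own H1 leaf `HsiehDescentLeafAtThree` (19405):
# given H1, the H2 crux IS the weakest H2 currency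

Cell `bsd-stepL` (run/shared/lean/pub/bsd-stepL/), seat `bsd-stepL-thmc-p1` (prover g4, D-0074 hands, 2026-08-26),
`--supports stmt-BirchSwinnertonDyer-19493`. Companion of `Theorems/ClassRecordThreeValueContinuityAtThreeSuppliers.lean`
(same session), whose §2 reads «crux ⟸ (VN₃ ∀ W) ∧ (a frame exists at every datum and EVERY `ι'`)» with the frame
hypothesis INLINE. Here that frame hypothesis is SUPPLIED BY NAME from what the route already carries for H1@3:

* Hsieh, Doc. Math. 19 (2014) Thm. 1 = the tree's named fact `hsieh2014_exists_anticyclotomicPAdicLFunction`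
  (`Literature/…/AnticyclotomicRankinSelbergPAdicLFunction.lean`; «p ∣ N allowed», `p` odd — `p = 3` included), and
* the by-name ASIDE leaf `HsiehDescentLeafAtThree` (item 19405: `∀ W, ClassX11b W 3 → Three.HsiehDescentAt₃ W`, the
  `R₀`-descent of Hsieh's element — the named H1 residual, `Three.HsiehDescentAt₃ W ↔ Three.HsiehFrameResidualAt₃ W`
  by `hsiehFrameResidualAt₃_iff_hsiehDescentAt₃`; its own kernel price is road A of the cell: Tate–Sen + BDP13 Thm. 5.5
  reciprocity, items 19238 ∕ 19281),

through S18(b)'s glue (`exists_isBDPLFunction_of_hsiehDisplay`, x11b3) read at the GIVEN `ι'` — S18(b) itself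
(`bdpExistsAt₃_of_hsieh2014`) only records the `∃ ι'` form `Three.BDPExistsAt₃ W`; the crux needs a frame at every
`ι'` inducing `𝔭`, which the residual provides verbatim (it is quantified over `ι'`).

## What this file records in the kernel (implications only; nothing discharged)

1. `forall_frames₃_of_hsieh2014_of_hsiehFrameResidualAt₃`: Hsieh's fact ∧ `HsiehFrameResidualAt₃ W` ⟹ at every X11b@3
   classical datum of `W` and EVERY `ι'` inducing `𝔭` there is a frame `(Ω_K ≠ 0, Ω_p ∈ R₀ˣ, L ∈ R₀⟦T⟧)` with
   `IsBDPLFunction ι' 𝔭 κ γ f Ω_K Ω_p L` (the ∀-`ι'` strengthening of S18(b)).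
2. `classicalFrameValue₃_of_normContinuity_of_hsieh2014_of_hsiehFrameResidualAt₃`: (VN₃) at `W` ∧ Hsieh ∧ residual ⟹
   THEOREM C typed at `W` (g3's `classicalFrameValue₃_of_normContinuity_of_frames`).
3. `classRecordThree_valueContinuityAtThree_of_normContinuity_of_hsieh2014_of_hsiehDescentLeaf`: **(VN₃) for every curve
   ∧ Hsieh 2014 Thm. 1 ∧ leaf 19405 ⟹ crux 19493**, concluding the route decl literally. With the Suppliers file's
   `normContinuity₃_classwide_of_classRecordThree_valueContinuityAtThree` (crux ⟹ (VN₃)): GIVEN the published fact and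
   the H1 leaf the route needs anyway, the H2 crux `ValueContinuityAtThree` and norm continuity at `𝟙` are EQUIVALENT —
   a restatement of 19493 in the (VN₃) currency (no unit, no `R₀`, no Λ-adic object; 3-adic absolute values of
   normalised central values only) would cost the route nothing. NOTE the loci: crux 19108 `HsiehDescentAtThree` gives
   `Three.HsiehDescentAt₃ W` only on (ram) ∧ split and ¬(ram) ∧ surj, while 19493 binds every X11b@3 curve with
   surjective image; hence the LEAF 19405 (all of X11b@3), not the crux 19108, is the right H1 input here.

HONEST FRAMING: every theorem is an implication; (VN₃), the residual ∕ leaf and THEOREM C typed are NOT discharged and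
NOT in print at `3 ∥ N` (memo THEOREM C ∕ Theorem A of PROOF-BDP); Hsieh's theorem enters as a named published fact
(hypothesis `hH`, conditional-result); nothing is booked; no node, label or census count moves (T7); O2 stays OPEN;
BSD(E,3) is proved for no class by this file.

References: [Hsieh2014] Doc. Math. 19 (2014) 709–767, Thm. 1 ∕ Thm. A (arXiv:1112.1580 pp. 3–4); [Castella2018] Camb.
J. Math. 6 (2018) = arXiv:1704.06608, Thm. 3.1–3.2 (pp. 8–9); [CastellaHsieh2018] Math. Ann. 370, Def. 3.5 ∕ Prop. 3.6;
cell memo PROOF-BDP v1.8 §3 (Theorem A), §20 (THEOREM C, Cor. C.6).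
-/

noncomputable section

open scoped Classical Topology

open Filter WeierstrassCurve NumberField IsDedekindDomain Field PowerSeries
  Literature.NumberTheory.EllipticCurves Literature.NumberTheory.EllipticCurves.ModularForms
  Literature.NumberTheory.EllipticCurves.Rank1Residual
  Literature.NumberTheory.GaloisRepresentations Literature.NumberTheory.GaloisCohomology
  Literature.NumberTheory.Automorphic
  Summit.BirchSwinnertonDyer.Rank1Residual Summit.BirchSwinnertonDyer.Rank1Residual.X11b
  Summit.BirchSwinnertonDyer.Rank1Residual.X11b.AcSelmer
  Summit.BirchSwinnertonDyer.Rank1Residual.X11b.CongruenceLimit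
  Summit.BirchSwinnertonDyer.Rank1Residual.X11b.Halves
  Summit.BirchSwinnertonDyer.Rank1Residual.X11b.Three
  Summit.BirchSwinnertonDyer.BirchSwinnertonDyer.Theses.ClassRecordThree

namespace Summit.BirchSwinnertonDyer.BirchSwinnertonDyer.Theorems

/-! ## §1 Frames at EVERY `ι'` from Hsieh's fact and the H1 residual -/

section OneCurve

variable {W : WeierstrassCurve ℚ} [W.IsElliptic] [W.IsGloballyMinimal]

/-- **Hsieh 2014 Thm. 1 ∧ `HsiehFrameResidualAt₃ W` ⟹ a BDP frame at every X11b@3 classical datum and EVERY `ι'`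
inducing `𝔭`** (the ∀-`ι'` form of S18(b) `bdpExistsAt₃_of_hsieh2014`, same proof read at the given `ι'`): the
residual supplies `(λ, r_λ)` and the `R₀`-frame of every Hsieh witness; the fact supplies the witness at `p = 3`
(`3 ≠ 2`, `3 ∥ N_E` from `ClassX11b W 3`, `K` imaginary quadratic with `3` split, `ι'` inducing `𝔭`, classical
Heegner hypothesis, `κ` anticyclotomic with generator `γ`); the glue `exists_isBDPLFunction_of_hsiehDisplay` turns
Hsieh's display into Castella's (`Ω_K₁ = (16A²/3)^{1/4}·Ω_K'`). CONDITIONAL on the named fact `hH` (published) and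
the residual `hres` (NOT in print at `3 ∣ N`). [cite: Hsieh2014, Thm. 1 (arXiv:1112.1580 pp. 3–4)]
[cite: Castella2018, Thm. 3.1 (arXiv:1704.06608 p. 9) (frame shape)] -/
theorem forall_frames₃_of_hsieh2014_of_hsiehFrameResidualAt₃
    (hH : hsieh2014_exists_anticyclotomicPAdicLFunction) (hres : HsiehFrameResidualAt₃ W) :
    ∀ (N : ℕ) [NeZero N] (K : Type) [Field K] [NumberField K] (Dt : ModularParametrizationData W N)
    (H : HeegnerDatum N (NumberField.discr K)) (ι : K →+* ℂ) (P : (W.baseChange K).toAffine.Point),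
    ClassX11b W 3 → Surj W 3 → W.conductorNorm ℤ = N → IsImaginaryQuadratic K →
    Odd (NumberField.discr K) → SatisfiesHeegnerHypothesis N K →
    (W.quadraticTwist (NumberField.discr K : ℚ)).entireLFunction 1 ≠ 0 →
    WeierstrassCurve.Affine.Point.map ι.toRatAlgHom P = heegnerPointComplex Dt H →
    ¬ (3 : ℤ) ∣ Dt.c → ¬ IsOfFinAddOrder P →
    ∀ (κ : ZpExtension K 3), κ.IsAnticyclotomic →
      ∀ (γ : Field.absoluteGaloisGroup K) [Fact (κ.IsTopGenerator γ)]
        (𝔭 : HeightOneSpectrum (𝓞 K)) (h𝔭 : ((3 : ℕ) : 𝓞 K) ∈ 𝔭.asIdeal)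
        (he : 𝔭.asIdeal.ramificationIdx (𝓞 ℚ) = 1) (hf : 𝔭.asIdeal.inertiaDeg (𝓞 ℚ) = 1),
        ∀ (f : CuspForm (CongruenceSubgroup.Gamma0 N) 2), IsNewformOf W f →
          ∀ (ι' : PadicAlgCl 3 ≃+* ℂ), InducesPrime ι' 𝔭 →
            ∃ (ΩK : ℂ) (Ωp : (unrIntegers 3)ˣ) (L : UnrSeries 3),
              ΩK ≠ 0 ∧ IsBDPLFunction ι' 𝔭 κ γ f ΩK ((Ωp : unrIntegers 3) : ℂ_[3]) L := by
  haveI : Fact (Nat.Prime 3) := ⟨Nat.prime_three⟩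
  intro N _ K _ _ Dt H ι P hX hsurj hN hK hodd hHeeg hL1 hP hc hP0 κ hκ γ hγ 𝔭 h𝔭 he hf f hnf ι' hι'
  have h3 : ((Ideal.span {(3 : ℤ)}).primesOver (𝓞 K)).ncard = 2 :=
    ncard_primesOver_three_eq_two_of_classX11b hX hN hHeeg
  have hHeegC : ∀ ℓ : ℕ, ℓ.Prime → ℓ ∣ N → ∃ v : HeightOneSpectrum (𝓞 K), Ideal.absNorm v.asIdeal = ℓ :=
    forall_exists_absNorm_eq_of_satisfiesHeegnerHypothesis hK.1 hHeeg
  obtain ⟨lam, rlam, hunit, hinfl, hAQ, hunrl, havl, hfacl, hR⟩ :=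
    hres ι' K 𝔭 κ γ hnf hX hsurj hN hK hodd hHeeg h3 h𝔭 he hf hι' hHeegC hκ hγ.out
  have h9 : ¬ 3 ^ 2 ∣ N := hN ▸ not_sq_dvd_conductorNorm_of_mult W 3 hX.2.2.1
  have h3N : 3 ∣ N := hN ▸ dvd_conductorNorm_of_mult hX.2.2.1
  obtain ⟨A, ΩK, C, Ωp, Q, hA, hΩK, hC, hΩp, hQ⟩ := hH ι' K 𝔭 κ γ f lam rlam (by norm_num) hnf.1 h9
    hK h3 h𝔭 hι' hHeeg hunit hinfl hAQ hunrl havl hfacl hκ hγ.out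
  obtain ⟨ΩK', Ωp', L, hΩK', hL⟩ := hR A ΩK C Ωp Q hA hΩK hC hΩp hQ
  obtain ⟨ΩK₁, hΩK₁, hBDP⟩ :=
    exists_isBDPLFunction_of_hsiehDisplay ι' 𝔭 κ γ f h3N hA hΩK' ((Ωp' : unrIntegers 3) : ℂ_[3]) L hL
  exact ⟨ΩK₁, Ωp', L, hΩK₁, hBDP⟩

/-- **(VN₃) at `W` ∧ Hsieh 2014 Thm. 1 ∧ `HsiehFrameResidualAt₃ W` ⟹ THEOREM C typed at `W`** (`h12` of
`Three.bdpValueAt₃_of_frameValue`): §1's frames fed to g3's `classicalFrameValue₃_of_normContinuity_of_frames`. So at a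
curve where H1's residual holds, norm continuity at `𝟙` already gives the full frame-value statement of memo THEOREM C.
CONDITIONAL on all three hypotheses. [cite: Hsieh2014, Thm. 1 (arXiv:1112.1580 pp. 3–4)]
[cite: Castella2018, Thm. 3.1–3.2 (arXiv:1704.06608 pp. 8–9) (frame and value shapes only; nothing asserted at p = 3)] -/
theorem classicalFrameValue₃_of_normContinuity_of_hsieh2014_of_hsiehFrameResidualAt₃
    (hVN : ∀ (N : ℕ) [NeZero N] (K : Type) [Field K] [NumberField K] (Dt : ModularParametrizationData W N)
      (H : HeegnerDatum N (NumberField.discr K)) (ι : K →+* ℂ) (P : (W.baseChange K).toAffine.Point),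
      ClassX11b W 3 → Surj W 3 → W.conductorNorm ℤ = N → IsImaginaryQuadratic K →
      Odd (NumberField.discr K) → SatisfiesHeegnerHypothesis N K →
      (W.quadraticTwist (NumberField.discr K : ℚ)).entireLFunction 1 ≠ 0 →
      WeierstrassCurve.Affine.Point.map ι.toRatAlgHom P = heegnerPointComplex Dt H →
      ¬ (3 : ℤ) ∣ Dt.c → ¬ IsOfFinAddOrder P →
      ∀ (κ : ZpExtension K 3), κ.IsAnticyclotomic →
        ∀ (γ : Field.absoluteGaloisGroup K) [Fact (κ.IsTopGenerator γ)]
          (𝔭 : HeightOneSpectrum (𝓞 K)) (h𝔭 : ((3 : ℕ) : 𝓞 K) ∈ 𝔭.asIdeal)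
          (he : 𝔭.asIdeal.ramificationIdx (𝓞 ℚ) = 1) (hf : 𝔭.asIdeal.inertiaDeg (𝓞 ℚ) = 1),
          ∀ (f : CuspForm (CongruenceSubgroup.Gamma0 N) 2), IsNewformOf W f →
            ∀ (ι' : PadicAlgCl 3 ≃+* ℂ), InducesPrime ι' 𝔭 →
              ∃ (ΩK : ℂ) (Ωp : ℂ_[3]), ΩK ≠ 0 ∧ Ωp ≠ 0 ∧
                ∀ (φ : ℕ → HeckeCharacter K) (n : ℕ → ℕ) (r : ℕ → FramedGaloisRep K (PadicAlgCl 3) 1),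
                  (∀ k, 0 < n k) → (∀ k (v : HeightOneSpectrum (𝓞 K)), (φ k).IsUnramifiedAt v) →
                  (∀ k, (φ k).HasInfinityType (fun _ ↦ (n k : ℤ)) (fun _ ↦ -(n k : ℤ))) →
                  (∀ k, IsPAdicAvatarOf ι' (φ k) (r k)) → (∀ k, FactorsThroughZp κ (r k)) →
                  Tendsto (fun k ↦ avatarValueAt (r k) γ) atTop (𝓝 1) →
                  Tendsto (fun k ↦ ‖((ι'.symm (bdpInterpolationValue 3 f 𝔭 (φ k) (n k) ΩK) :
                    PadicAlgCl 3) : ℂ_[3]) * Ωp ^ (4 * n k)‖) atTop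
                    (𝓝 (‖algebraMap ℚ_[3] ℂ_[3] (((1 : ℚ_[3]) - ((W.LFunction 3 : ℤ) : ℚ_[3]) *
                        (3 : ℚ_[3])⁻¹) * logOmega W 3 (embAt K 3 𝔭 h𝔭 he hf) P)‖ ^ 2)))
    (hH : hsieh2014_exists_anticyclotomicPAdicLFunction) (hres : HsiehFrameResidualAt₃ W) :
    ∀ (N : ℕ) [NeZero N] (K : Type) [Field K] [NumberField K] (Dt : ModularParametrizationData W N)
    (H : HeegnerDatum N (NumberField.discr K)) (ι : K →+* ℂ) (P : (W.baseChange K).toAffine.Point),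
    ClassX11b W 3 → Surj W 3 → W.conductorNorm ℤ = N → IsImaginaryQuadratic K →
    Odd (NumberField.discr K) → SatisfiesHeegnerHypothesis N K →
    (W.quadraticTwist (NumberField.discr K : ℚ)).entireLFunction 1 ≠ 0 →
    WeierstrassCurve.Affine.Point.map ι.toRatAlgHom P = heegnerPointComplex Dt H →
    ¬ (3 : ℤ) ∣ Dt.c → ¬ IsOfFinAddOrder P →
    ∀ (κ : ZpExtension K 3), κ.IsAnticyclotomic →
      ∀ (γ : Field.absoluteGaloisGroup K) [Fact (κ.IsTopGenerator γ)]
        (𝔭 : HeightOneSpectrum (𝓞 K)) (h𝔭 : ((3 : ℕ) : 𝓞 K) ∈ 𝔭.asIdeal)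
        (he : 𝔭.asIdeal.ramificationIdx (𝓞 ℚ) = 1) (hf : 𝔭.asIdeal.inertiaDeg (𝓞 ℚ) = 1),
        ∀ (f : CuspForm (CongruenceSubgroup.Gamma0 N) 2), IsNewformOf W f →
          ∀ (ι' : PadicAlgCl 3 ≃+* ℂ), InducesPrime ι' 𝔭 →
            ∃ (ΩK : ℂ) (Ωp : (unrIntegers 3)ˣ) (L : UnrSeries 3),
              ΩK ≠ 0 ∧ IsBDPLFunction ι' 𝔭 κ γ f ΩK ((Ωp : unrIntegers 3) : ℂ_[3]) L ∧
              ∃ u : (unrIntegers 3)ˣ, L.HasValueAt 0 (((u : unrIntegers 3) : ℂ_[3]) *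
                (algebraMap ℚ_[3] ℂ_[3] (((1 : ℚ_[3]) - ((W.LFunction 3 : ℤ) : ℚ_[3]) * (3 : ℚ_[3])⁻¹) *
                  logOmega W 3 (embAt K 3 𝔭 h𝔭 he hf) P)) ^ 2) :=
  classicalFrameValue₃_of_normContinuity_of_frames hVN
    (forall_frames₃_of_hsieh2014_of_hsiehFrameResidualAt₃ hH hres)

end OneCurve

/-! ## §2 The crux from (VN₃), Hsieh's fact and the H1 leaf 19405 -/

/-- **Crux `ValueContinuityAtThree` (19493) ⟸ (VN₃) for every curve ∧ Hsieh 2014 Thm. 1 ∧ the aside leaf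
`HsiehDescentLeafAtThree` (19405).** At each curve and datum: `ClassX11b W 3` (from the datum) and the leaf give
`Three.HsiehDescentAt₃ W`, hence the residual (`hsiehFrameResidualAt₃_of_hsiehDescentAt₃`), hence frames at every
`ι'` (§1), hence THEOREM C typed at `W` (§1), hence (VC₃) at `W` (g2's `valueContinuity₃_of_classicalFrameValue`).
Read with the converse `normContinuity₃_classwide_of_classRecordThree_valueContinuityAtThree`: GIVEN `hH` and the
leaf 19405 — both inputs the route needs for H1 in any case — crux 19493 and (VN₃) are EQUIVALENT. CONDITIONAL on
`hVN` (not in print at `3 ∥ N`), the named fact `hH` (published) and the leaf `hD` (item 19405, open).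
[cite: Hsieh2014, Thm. 1 (arXiv:1112.1580 pp. 3–4)]
[cite: Castella2018, Thm. 3.1–3.2 (arXiv:1704.06608 pp. 8–9) (display, frame and value shapes only; nothing asserted at p = 3)] -/
theorem classRecordThree_valueContinuityAtThree_of_normContinuity_of_hsieh2014_of_hsiehDescentLeaf
    (hVN : ∀ (W : WeierstrassCurve ℚ) [W.IsElliptic] [W.IsGloballyMinimal],
      ∀ (N : ℕ) [NeZero N] (K : Type) [Field K] [NumberField K] (Dt : ModularParametrizationData W N)
      (H : HeegnerDatum N (NumberField.discr K)) (ι : K →+* ℂ) (P : (W.baseChange K).toAffine.Point),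
      ClassX11b W 3 → Surj W 3 → W.conductorNorm ℤ = N → IsImaginaryQuadratic K →
      Odd (NumberField.discr K) → SatisfiesHeegnerHypothesis N K →
      (W.quadraticTwist (NumberField.discr K : ℚ)).entireLFunction 1 ≠ 0 →
      WeierstrassCurve.Affine.Point.map ι.toRatAlgHom P = heegnerPointComplex Dt H →
      ¬ (3 : ℤ) ∣ Dt.c → ¬ IsOfFinAddOrder P →
      ∀ (κ : ZpExtension K 3), κ.IsAnticyclotomic →
        ∀ (γ : Field.absoluteGaloisGroup K) [Fact (κ.IsTopGenerator γ)]
          (𝔭 : HeightOneSpectrum (𝓞 K)) (h𝔭 : ((3 : ℕ) : 𝓞 K) ∈ 𝔭.asIdeal)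
          (he : 𝔭.asIdeal.ramificationIdx (𝓞 ℚ) = 1) (hf : 𝔭.asIdeal.inertiaDeg (𝓞 ℚ) = 1),
          ∀ (f : CuspForm (CongruenceSubgroup.Gamma0 N) 2), IsNewformOf W f →
            ∀ (ι' : PadicAlgCl 3 ≃+* ℂ), InducesPrime ι' 𝔭 →
              ∃ (ΩK : ℂ) (Ωp : ℂ_[3]), ΩK ≠ 0 ∧ Ωp ≠ 0 ∧
                ∀ (φ : ℕ → HeckeCharacter K) (n : ℕ → ℕ) (r : ℕ → FramedGaloisRep K (PadicAlgCl 3) 1),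
                  (∀ k, 0 < n k) → (∀ k (v : HeightOneSpectrum (𝓞 K)), (φ k).IsUnramifiedAt v) →
                  (∀ k, (φ k).HasInfinityType (fun _ ↦ (n k : ℤ)) (fun _ ↦ -(n k : ℤ))) →
                  (∀ k, IsPAdicAvatarOf ι' (φ k) (r k)) → (∀ k, FactorsThroughZp κ (r k)) →
                  Tendsto (fun k ↦ avatarValueAt (r k) γ) atTop (𝓝 1) →
                  Tendsto (fun k ↦ ‖((ι'.symm (bdpInterpolationValue 3 f 𝔭 (φ k) (n k) ΩK) :
                    PadicAlgCl 3) : ℂ_[3]) * Ωp ^ (4 * n k)‖) atTop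
                    (𝓝 (‖algebraMap ℚ_[3] ℂ_[3] (((1 : ℚ_[3]) - ((W.LFunction 3 : ℤ) : ℚ_[3]) *
                        (3 : ℚ_[3])⁻¹) * logOmega W 3 (embAt K 3 𝔭 h𝔭 he hf) P)‖ ^ 2)))
    (hH : hsieh2014_exists_anticyclotomicPAdicLFunction) (hD : HsiehDescentLeafAtThree) :
    ValueContinuityAtThree := by
  intro W _ _ N _ K _ _ Dt H ι P hX
  have hres : HsiehFrameResidualAt₃ W := hsiehFrameResidualAt₃_of_hsiehDescentAt₃ W (hD W hX)
  exact valueContinuity₃_of_classicalFrameValue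
    (classicalFrameValue₃_of_normContinuity_of_hsieh2014_of_hsiehFrameResidualAt₃ (hVN W) hH hres)
    N K Dt H ι P hX

/-- **The same with the residual of record `Three.HsiehFrameResidualAt₃` for every X11b@3 curve in place of the
leaf** (`HsiehFrameResidualAt₃ W ↔ HsiehDescentAt₃ W`, `hsiehFrameResidualAt₃_iff_hsiehDescentAt₃`).
[cite: Hsieh2014, Thm. 1 (arXiv:1112.1580 pp. 3–4)] -/
theorem classRecordThree_valueContinuityAtThree_of_normContinuity_of_hsieh2014_of_hsiehFrameResidual
    (hVN : ∀ (W : WeierstrassCurve ℚ) [W.IsElliptic] [W.IsGloballyMinimal],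
      ∀ (N : ℕ) [NeZero N] (K : Type) [Field K] [NumberField K] (Dt : ModularParametrizationData W N)
      (H : HeegnerDatum N (NumberField.discr K)) (ι : K →+* ℂ) (P : (W.baseChange K).toAffine.Point),
      ClassX11b W 3 → Surj W 3 → W.conductorNorm ℤ = N → IsImaginaryQuadratic K →
      Odd (NumberField.discr K) → SatisfiesHeegnerHypothesis N K →
      (W.quadraticTwist (NumberField.discr K : ℚ)).entireLFunction 1 ≠ 0 →
      WeierstrassCurve.Affine.Point.map ι.toRatAlgHom P = heegnerPointComplex Dt H →
      ¬ (3 : ℤ) ∣ Dt.c → ¬ IsOfFinAddOrder P →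
      ∀ (κ : ZpExtension K 3), κ.IsAnticyclotomic →
        ∀ (γ : Field.absoluteGaloisGroup K) [Fact (κ.IsTopGenerator γ)]
          (𝔭 : HeightOneSpectrum (𝓞 K)) (h𝔭 : ((3 : ℕ) : 𝓞 K) ∈ 𝔭.asIdeal)
          (he : 𝔭.asIdeal.ramificationIdx (𝓞 ℚ) = 1) (hf : 𝔭.asIdeal.inertiaDeg (𝓞 ℚ) = 1),
          ∀ (f : CuspForm (CongruenceSubgroup.Gamma0 N) 2), IsNewformOf W f →
            ∀ (ι' : PadicAlgCl 3 ≃+* ℂ), InducesPrime ι' 𝔭 →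
              ∃ (ΩK : ℂ) (Ωp : ℂ_[3]), ΩK ≠ 0 ∧ Ωp ≠ 0 ∧
                ∀ (φ : ℕ → HeckeCharacter K) (n : ℕ → ℕ) (r : ℕ → FramedGaloisRep K (PadicAlgCl 3) 1),
                  (∀ k, 0 < n k) → (∀ k (v : HeightOneSpectrum (𝓞 K)), (φ k).IsUnramifiedAt v) →
                  (∀ k, (φ k).HasInfinityType (fun _ ↦ (n k : ℤ)) (fun _ ↦ -(n k : ℤ))) →
                  (∀ k, IsPAdicAvatarOf ι' (φ k) (r k)) → (∀ k, FactorsThroughZp κ (r k)) →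
                  Tendsto (fun k ↦ avatarValueAt (r k) γ) atTop (𝓝 1) →
                  Tendsto (fun k ↦ ‖((ι'.symm (bdpInterpolationValue 3 f 𝔭 (φ k) (n k) ΩK) :
                    PadicAlgCl 3) : ℂ_[3]) * Ωp ^ (4 * n k)‖) atTop
                    (𝓝 (‖algebraMap ℚ_[3] ℂ_[3] (((1 : ℚ_[3]) - ((W.LFunction 3 : ℤ) : ℚ_[3]) *
                        (3 : ℚ_[3])⁻¹) * logOmega W 3 (embAt K 3 𝔭 h𝔭 he hf) P)‖ ^ 2)))
    (hH : hsieh2014_exists_anticyclotomicPAdicLFunction)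
    (hres : ∀ (W : WeierstrassCurve ℚ) [W.IsElliptic] [W.IsGloballyMinimal],
      ClassX11b W 3 → HsiehFrameResidualAt₃ W) :
    ValueContinuityAtThree := by
  intro W _ _ N _ K _ _ Dt H ι P hX
  exact valueContinuity₃_of_classicalFrameValue
    (classicalFrameValue₃_of_normContinuity_of_hsieh2014_of_hsiehFrameResidualAt₃ (hVN W) hH (hres W hX))
    N K Dt H ι P hX

end Summit.BirchSwinnertonDyer.BirchSwinnertonDyer.Theorems

end
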